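import Literature.Topology.FourManifolds.OneHandleBoundaryStepProofs
import HarnessLib

/-!
# Stub `stub_factOneHandlebodyBoundary` (T3) for the line `sphere_split` of `VrlSliceRigidity`

Kirby's sentence `∂(♮ⁿ S¹ × B³) = #ⁿ(S² × S¹)` (R. C. Kirby, *The topology of 4-manifolds*
(1989), Ch. I §2, p. 8): for every `n` some compact connected orientable `4`-dimensional
`(1,n)`-handlebody has a boundary datum which is `#ⁿ(S² × S¹)` in the recursive connected-sum
sense `IsSphereTwoProdCircleSum n` — the Literature named fact
`exists_oneHandlebody_four_boundary_isSphereTwoProdCircleSum` (`OneHandlebodyBoundarySum.lean`),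
discharged in `OneHandleBoundaryStepProofs.lean` from the one-handle step
(Kosinski 1993, VI §9, (3.1), (6.6); Milnor 1965, Thm. 3.13).
-/

noncomputable section

set_option linter.dupNamespace false

namespace Summit.SmoothPoincare4.SmoothPoincare4.Theorems.VrlSliceRigidity.SphereSplit

/-- **T3: the boundary of a `4`-dimensional `(1,n)`-handlebody is `#ⁿ(S² × S¹)`** (Kirby 1989,
Ch. I §2, p. 8), in the existence form of the Literature fact
`exists_oneHandlebody_four_boundary_isSphereTwoProdCircleSum`, now a theorem
(`…_holds`, `OneHandleBoundaryStepProofs.lean`). -/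
theorem stub_factOneHandlebodyBoundary :
    Literature.Topology.FourManifolds.exists_oneHandlebody_four_boundary_isSphereTwoProdCircleSum :=
  Literature.Topology.FourManifolds.exists_oneHandlebody_four_boundary_isSphereTwoProdCircleSum_holds

end Summit.SmoothPoincare4.SmoothPoincare4.Theorems.VrlSliceRigidity.SphereSplit

end
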